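import Literature.Computability.AlgebraicComplexity.MatMulMonomialSubrank
import Literature.Computability.AlgebraicComplexity.GroupAlgebraTensor
import HarnessLib

/-!
# Relative exponents: the triangle inequality (CVZ Prop. 3 / Prop. 7) and bounding lemmas

Topic `Literature/Computability/AlgebraicComplexity`; sibling of `RelativeExponent.lean`
(definitions `restrictionCost`, `relativeExponent = ω(t,s)`, `monRelativeExponent = ω_M(t,s)`,
after M. Christandl, P. Vrana, J. Zuiddam, *Barriers for fast matrix multiplication from
irreversibility*, Theory of Computing 17 (2021), art. 2 = arXiv:1812.06952, **arXiv numbering**: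
Def. 2 / Prop. 3 p. 5, §2.4 / Prop. 7 p. 6), of `RelativeExponentProofs.lean` (monomial
restriction calculus) and of `MatMulMonomialSubrank.lean`. Everything in this file is PROVED, over
a commutative semiring.

## Content

* Relabelling lemmas, monomial form (hence also plain): `tensorMonRestrictsTo_of_reindex`,
  `kroneckerPow_unitTensor_eq` and `tensorMonRestrictsTo_unitTensor_pow` /
  `tensorMonRestrictsTo_pow_unitTensor` (`⟨b⟩^{⊗n} ≅ ⟨bⁿ⟩`), `tensorMonRestrictsTo_unitTensor_castLE`
  (`⟨R⟩ ≥_M ⟨r⟩`, `r ≤ R`), `tensorMonRestrictsTo_kroneckerPow_one` /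
  `tensorMonRestrictsTo_one_kroneckerPow` (`t^{⊗1} ≅ t`), `tensorMonRestrictsTo_chain` /
  `tensorRestrictsTo_chain` (from `s^{⊗k} ≥ t^{⊗p}`, `t^{⊗m} ≥ u^{⊗n}` to `s^{⊗mk} ≥ u^{⊗pn}`, using
  both directions of the power-of-a-power relabelling, `tensorMonRestrictsTo_kroneckerPow_mul` of
  `RelativeExponentProofs.lean` and `tensorMonRestrictsTo_kroneckerPow_mul'` of
  `MatMulMonomialSubrank.lean`).
* Bounding a relative exponent: `relativeExponent_eq_zero_of_not_exists` (an empty defining set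
  forces the junk value `0`), `le_relativeExponent_of_forall` (a lower bound valid for every
  witness `t^{⊗m} ≥ s^{⊗(n+1)}` bounds `ω(t,s)` from below once every defining set is nonempty),
  `relativeExponent_le_of_forall_pos` / `monRelativeExponent_le_of_forall_pos` (witnesses of ratio
  `≤ c + ε` for every `ε > 0` bound `ω`, `ω_M` by `c`), and the monomial analogues.
* **CVZ Prop. 3 (second item) / Prop. 7 (second item), the triangle inequality**
  `ω(s,u) ≤ ω(s,t) · ω(t,u)` (`relativeExponent_triangle`) and
  `ω_M(s,u) ≤ ω_M(s,t) · ω_M(t,u)` (`monRelativeExponent_triangle`), for the tree's infimum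
  formalisation, under the finiteness hypotheses that every set defining `ω(s,t)` and `ω(t,u)`
  (resp. `ω_M`) is nonempty (in print the excluded cases read `∞ · x ≥ y`; with the junk value `0`
  of an empty `Nat.sInf` the hypothesis-free Lean statement fails, e.g. `s = u = ⟨2⟩`, `t = 0`).

## Proof of the triangle inequality

CVZ print no proof ("the reader verifies directly", §2.2). For `p, n ≥ 1` let
`k = min {k | s^{⊗k} ≥ t^{⊗p}}` and `m = min {m | t^{⊗m} ≥ u^{⊗n}}` (members of their sets by
nonemptiness). Restrictions compose and are compatible with tensor powers, and powers of powers
are powers up to relabelling, so `s^{⊗mk} ≥ (s^{⊗k})^{⊗m} ≥ (t^{⊗p})^{⊗m} ≥ t^{⊗pm} ≥ (t^{⊗m})^{⊗p}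
≥ (u^{⊗n})^{⊗p} ≥ u^{⊗pn}`; hence `ω(s,u) ≤ mk/(pn) = (k/p)(m/n)`, and taking infima over `p` and
`n` separately (all terms are nonnegative, `le_ciInf_mul_ciInf`) gives the claim.

## References

* M. Christandl, P. Vrana, J. Zuiddam, ToC 17 (2021), art. 2 = arXiv:1812.06952, Def. 2,
  Prop. 3 (p. 5), §2.4, Prop. 7 (p. 6). [ChristandlVranaZuiddam2021]
-/

noncomputable section

open scoped BigOperators

namespace Literature.Computability.AlgebraicComplexity

universe u

/-! ## Relabelling lemmas (monomial form) -/

section Reindex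

variable {K : Type u} [CommSemiring K]
variable {ι κ μ ι' κ' μ' : Type*}

/-- Relabelling along bijections is a monomial restriction in both directions; here the direction
`t ∘ (e₁ × e₂ × e₃) ≥_M t` (the other one is `tensorMonRestrictsTo_precomp`). [folklore] -/
theorem tensorMonRestrictsTo_of_reindex [Fintype ι] [Fintype κ] [Fintype μ] [Fintype ι']
    [Fintype κ'] [Fintype μ'] (t : ι → κ → μ → K) (e₁ : ι' ≃ ι) (e₂ : κ' ≃ κ) (e₃ : μ' ≃ μ) :
    TensorMonRestrictsTo (fun a b c => t (e₁ a) (e₂ b) (e₃ c)) t := by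
  have := tensorMonRestrictsTo_precomp (fun a b c => t (e₁ a) (e₂ b) (e₃ c))
    e₁.symm.injective e₂.symm.injective e₃.symm.injective
  simpa using this

/-- `t^{⊗1}` is the relabelling of `t` along `x ↦ x 0`. [folklore] -/
theorem kroneckerPow_one_eq (t : ι → κ → μ → K) :
    kroneckerPow t 1 = fun a b c => t (a 0) (b 0) (c 0) := by
  funext a b c
  simp [kroneckerPow_apply]

/-- `t ≥_M t^{⊗1}`. [folklore] -/
theorem tensorMonRestrictsTo_kroneckerPow_one [Fintype ι] [Fintype κ] [Fintype μ]
    (t : ι → κ → μ → K) : TensorMonRestrictsTo t (kroneckerPow t 1) := by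
  rw [kroneckerPow_one_eq]
  have h : Function.Injective fun a : Fin 1 → ι => a 0 := fun a₁ a₂ e => funext fun i => by
    rw [Subsingleton.elim i 0]; exact e
  have h' : Function.Injective fun a : Fin 1 → κ => a 0 := fun a₁ a₂ e => funext fun i => by
    rw [Subsingleton.elim i 0]; exact e
  have h'' : Function.Injective fun a : Fin 1 → μ => a 0 := fun a₁ a₂ e => funext fun i => by
    rw [Subsingleton.elim i 0]; exact e
  exact tensorMonRestrictsTo_precomp t h h' h''

/-- `t^{⊗1} ≥_M t`. [folklore] -/
theorem tensorMonRestrictsTo_one_kroneckerPow [Fintype ι] [Fintype κ] [Fintype μ]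
    (t : ι → κ → μ → K) : TensorMonRestrictsTo (kroneckerPow t 1) t := by
  have e : t = fun a b c => kroneckerPow t 1 (fun _ => a) (fun _ => b) (fun _ => c) := by
    funext a b c
    simp [kroneckerPow_apply]
  have h₁ : Function.Injective fun (a : ι) (_ : Fin 1) => a := fun a₁ a₂ h => by
    simpa using congrFun h 0
  have h₂ : Function.Injective fun (b : κ) (_ : Fin 1) => b := fun a₁ a₂ h => by
    simpa using congrFun h 0
  have h₃ : Function.Injective fun (c : μ) (_ : Fin 1) => c := fun a₁ a₂ h => by
    simpa using congrFun h 0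
  convert tensorMonRestrictsTo_precomp (kroneckerPow t 1) h₁ h₂ h₃ using 1

/-- **`⟨b⟩^{⊗n}` is the relabelling of `⟨bⁿ⟩`** along `finFunctionFinEquiv : (Fin n → Fin b) ≃ Fin (bⁿ)`:
both have entry `1` exactly on the diagonal. [folklore] -/
theorem kroneckerPow_unitTensor_eq (b n : ℕ) :
    kroneckerPow (unitTensor K b) n = fun x y z =>
      unitTensor K (b ^ n) (finFunctionFinEquiv x) (finFunctionFinEquiv y)
        (finFunctionFinEquiv z) := by
  funext x y z
  simp only [kroneckerPow_apply, unitTensor_apply, EmbeddingLike.apply_eq_iff_eq]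
  by_cases h : x = y ∧ y = z
  · rw [if_pos h]
    obtain ⟨rfl, rfl⟩ := h
    simp
  · rw [if_neg h]
    have : ∃ l, ¬ (x l = y l ∧ y l = z l) := by
      by_contra hall
      push Not at hall
      exact h ⟨funext fun l => (hall l).1, funext fun l => (hall l).2⟩
    obtain ⟨l, hl⟩ := this
    exact Finset.prod_eq_zero (Finset.mem_univ l) (if_neg hl)

/-- `⟨bⁿ⟩ ≥_M ⟨b⟩^{⊗n}`. [folklore] -/
theorem tensorMonRestrictsTo_unitTensor_pow (b n : ℕ) :
    TensorMonRestrictsTo (unitTensor K (b ^ n)) (kroneckerPow (unitTensor K b) n) := by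
  rw [kroneckerPow_unitTensor_eq]
  exact tensorMonRestrictsTo_precomp _ (Equiv.injective _) (Equiv.injective _) (Equiv.injective _)

/-- `⟨b⟩^{⊗n} ≥_M ⟨bⁿ⟩`. [folklore] -/
theorem tensorMonRestrictsTo_pow_unitTensor (b n : ℕ) :
    TensorMonRestrictsTo (kroneckerPow (unitTensor K b) n) (unitTensor K (b ^ n)) := by
  have e : unitTensor K (b ^ n) = fun x y z => kroneckerPow (unitTensor K b) n
      (finFunctionFinEquiv.symm x) (finFunctionFinEquiv.symm y) (finFunctionFinEquiv.symm z) := by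
    rw [kroneckerPow_unitTensor_eq]
    funext x y z
    simp
  rw [e]
  exact tensorMonRestrictsTo_precomp _ (Equiv.injective _) (Equiv.injective _) (Equiv.injective _)

/-- `⟨R⟩ ≥_M ⟨r⟩` for `r ≤ R` (zero-padding; `Fin.castLE` is injective). [folklore] -/
theorem tensorMonRestrictsTo_unitTensor_castLE {r R : ℕ} (h : r ≤ R) :
    TensorMonRestrictsTo (unitTensor K R) (unitTensor K r) := by
  have e : unitTensor K r = fun i j k =>
      unitTensor K R (Fin.castLE h i) (Fin.castLE h j) (Fin.castLE h k) := by
    funext i j k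
    simp [unitTensor_apply, Fin.ext_iff]
  rw [e]
  exact tensorMonRestrictsTo_precomp _ (Fin.castLE_injective h) (Fin.castLE_injective h)
    (Fin.castLE_injective h)

/-- Monomial bridge between propositionally equal exponents. [folklore] -/
theorem tensorMonRestrictsTo_kroneckerPow_of_eq [Fintype ι] [Fintype κ] [Fintype μ]
    [DecidableEq ι] [DecidableEq κ] [DecidableEq μ] (t : ι → κ → μ → K) {N N' : ℕ} (h : N = N') :
    TensorMonRestrictsTo (kroneckerPow t N) (kroneckerPow t N') := by
  subst h
  exact TensorMonRestrictsTo.refl _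

/-- From witnesses `s^{⊗k} ≥_M t^{⊗p}` and `t^{⊗m} ≥_M u^{⊗n}` to `s^{⊗(m k)} ≥_M u^{⊗(p n)}`
(compose, power, relabel). [cite: ChristandlVranaZuiddam2021, Prop. 7] -/
theorem tensorMonRestrictsTo_chain {ιs κs μs ιu κu μu : Type*} [Fintype ιs] [Fintype κs]
    [Fintype μs] [Fintype ι] [Fintype κ] [Fintype μ] [Fintype ιu] [Fintype κu] [Fintype μu]
    {s : ιs → κs → μs → K} {t : ι → κ → μ → K} {u : ιu → κu → μu → K} {k p m n : ℕ}
    (h₁ : TensorMonRestrictsTo (kroneckerPow s k) (kroneckerPow t p))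
    (h₂ : TensorMonRestrictsTo (kroneckerPow t m) (kroneckerPow u n)) :
    TensorMonRestrictsTo (kroneckerPow s (m * k)) (kroneckerPow u (p * n)) := by
  classical
  have hs : TensorMonRestrictsTo (kroneckerPow s (m * k)) (kroneckerPow t (m * p)) :=
    ((tensorMonRestrictsTo_kroneckerPow_mul s m k).trans (h₁.kroneckerPow m)).trans
      (tensorMonRestrictsTo_kroneckerPow_mul' t m p)
  have ht : TensorMonRestrictsTo (kroneckerPow t (p * m)) (kroneckerPow u (p * n)) :=
    ((tensorMonRestrictsTo_kroneckerPow_mul t p m).trans (h₂.kroneckerPow p)).trans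
      (tensorMonRestrictsTo_kroneckerPow_mul' u p n)
  exact (hs.trans (tensorMonRestrictsTo_kroneckerPow_of_eq t (mul_comm m p))).trans ht

/-- Plain version of `tensorMonRestrictsTo_chain`: from `s^{⊗k} ≥ t^{⊗p}` and `t^{⊗m} ≥ u^{⊗n}` to
`s^{⊗(m k)} ≥ u^{⊗(p n)}`. [cite: ChristandlVranaZuiddam2021, Prop. 3] -/
theorem tensorRestrictsTo_chain {ιs κs μs ιu κu μu : Type*} [Fintype ιs] [Fintype κs]
    [Fintype μs] [Fintype ι] [Fintype κ] [Fintype μ] [Fintype ιu] [Fintype κu] [Fintype μu]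
    {s : ιs → κs → μs → K} {t : ι → κ → μ → K} {u : ιu → κu → μu → K} {k p m n : ℕ}
    (h₁ : TensorRestrictsTo (kroneckerPow s k) (kroneckerPow t p))
    (h₂ : TensorRestrictsTo (kroneckerPow t m) (kroneckerPow u n)) :
    TensorRestrictsTo (kroneckerPow s (m * k)) (kroneckerPow u (p * n)) := by
  classical
  have hs : TensorRestrictsTo (kroneckerPow s (m * k)) (kroneckerPow t (m * p)) :=
    ((tensorMonRestrictsTo_kroneckerPow_mul s m k).tensorRestrictsTo.trans
      (h₁.kroneckerPow m)).trans (tensorMonRestrictsTo_kroneckerPow_mul' t m p).tensorRestrictsTo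
  have ht : TensorRestrictsTo (kroneckerPow t (p * m)) (kroneckerPow u (p * n)) :=
    ((tensorMonRestrictsTo_kroneckerPow_mul t p m).tensorRestrictsTo.trans
      (h₂.kroneckerPow p)).trans (tensorMonRestrictsTo_kroneckerPow_mul' u p n).tensorRestrictsTo
  exact (hs.trans
    (tensorMonRestrictsTo_kroneckerPow_of_eq t (mul_comm m p)).tensorRestrictsTo).trans ht

end Reindex

/-! ## Bounding relative exponents -/

section Bounds

variable {K : Type u} [CommSemiring K]
variable {ι κ μ ι' κ' μ' : Type*} [Fintype ι] [Fintype κ] [Fintype μ]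

/-- If no power of `t` restricts to `s^{⊗(n+1)}` for some `n`, then `ω(t,s)` takes the junk value `0`
(the `n`-th term of the infimum is `(Nat.sInf ∅)/(n+1) = 0` and all terms are `≥ 0`).
[cite: ChristandlVranaZuiddam2021, Def. 2] -/
theorem relativeExponent_eq_zero_of_not_exists {t : ι → κ → μ → K} {s : ι' → κ' → μ' → K} {n : ℕ}
    (h : ¬ ∃ m, TensorRestrictsTo (kroneckerPow t m) (kroneckerPow s (n + 1))) :
    relativeExponent t s = 0 := by
  refine le_antisymm ?_ (relativeExponent_nonneg t s)
  have hcost : restrictionCost t s (n + 1) = 0 := by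
    unfold restrictionCost
    have : {m : ℕ | TensorRestrictsTo (kroneckerPow t m) (kroneckerPow s (n + 1))} = ∅ :=
      Set.eq_empty_iff_forall_notMem.2 fun m hm => h ⟨m, hm⟩
    rw [this, Nat.sInf_empty]
  calc relativeExponent t s ≤ (restrictionCost t s (n + 1) : ℝ) / ((n : ℝ) + 1) :=
        ciInf_le (relativeExponent_bddBelow t s) n
    _ = 0 := by rw [hcost, Nat.cast_zero, zero_div]

/-- Monomial analogue: an empty defining set forces `ω_M(t,s) = 0`.
[cite: ChristandlVranaZuiddam2021, §2.4] -/
theorem monRelativeExponent_eq_zero_of_not_exists {t : ι → κ → μ → K} {s : ι' → κ' → μ' → K}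
    {n : ℕ} (h : ¬ ∃ m, TensorMonRestrictsTo (kroneckerPow t m) (kroneckerPow s (n + 1))) :
    monRelativeExponent t s = 0 := by
  refine le_antisymm ?_ (monRelativeExponent_nonneg t s)
  have hcost : monRestrictionCost t s (n + 1) = 0 := by
    unfold monRestrictionCost
    have : {m : ℕ | TensorMonRestrictsTo (kroneckerPow t m) (kroneckerPow s (n + 1))} = ∅ :=
      Set.eq_empty_iff_forall_notMem.2 fun m hm => h ⟨m, hm⟩
    rw [this, Nat.sInf_empty]
  calc monRelativeExponent t s ≤ (monRestrictionCost t s (n + 1) : ℝ) / ((n : ℝ) + 1) :=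
        ciInf_le (monRelativeExponent_bddBelow t s) n
    _ = 0 := by rw [hcost, Nat.cast_zero, zero_div]

/-- The minimum `min {m | t^{⊗m} ≥ s^{⊗n}}` is a witness when the set is nonempty.
[cite: ChristandlVranaZuiddam2021, Def. 2] -/
theorem tensorRestrictsTo_restrictionCost_of_nonempty {t : ι → κ → μ → K} {s : ι' → κ' → μ' → K} {n : ℕ}
    (h : ∃ m, TensorRestrictsTo (kroneckerPow t m) (kroneckerPow s n)) :
    TensorRestrictsTo (kroneckerPow t (restrictionCost t s n)) (kroneckerPow s n) :=
  Nat.sInf_mem (s := {m : ℕ | TensorRestrictsTo (kroneckerPow t m) (kroneckerPow s n)}) h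

/-- Monomial analogue of `tensorRestrictsTo_restrictionCost_of_nonempty`. [cite: ChristandlVranaZuiddam2021, §2.4] -/
theorem tensorMonRestrictsTo_monRestrictionCost_of_nonempty {t : ι → κ → μ → K} {s : ι' → κ' → μ' → K}
    {n : ℕ} (h : ∃ m, TensorMonRestrictsTo (kroneckerPow t m) (kroneckerPow s n)) :
    TensorMonRestrictsTo (kroneckerPow t (monRestrictionCost t s n)) (kroneckerPow s n) :=
  Nat.sInf_mem (s := {m : ℕ | TensorMonRestrictsTo (kroneckerPow t m) (kroneckerPow s n)}) h

/-- **Lower bounds on `ω(t,s)`**: if `c · n ≤ m` for every witness `t^{⊗m} ≥ s^{⊗n}` (`n ≥ 1`) and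
every defining set is nonempty, then `c ≤ ω(t,s)`. [cite: ChristandlVranaZuiddam2021, Def. 2] -/
theorem le_relativeExponent_of_forall {t : ι → κ → μ → K} {s : ι' → κ' → μ' → K} {c : ℝ}
    (hne : ∀ n, ∃ m, TensorRestrictsTo (kroneckerPow t m) (kroneckerPow s (n + 1)))
    (hc : ∀ m n, TensorRestrictsTo (kroneckerPow t m) (kroneckerPow s (n + 1)) →
      c * ((n : ℝ) + 1) ≤ m) :
    c ≤ relativeExponent t s := by
  refine le_ciInf fun n => ?_
  have hpos : (0 : ℝ) < (n : ℝ) + 1 := by positivity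
  rw [le_div_iff₀ hpos]
  exact hc _ n (tensorRestrictsTo_restrictionCost_of_nonempty (hne n))

/-- Monomial analogue of `le_relativeExponent_of_forall`. [cite: ChristandlVranaZuiddam2021, §2.4] -/
theorem le_monRelativeExponent_of_forall {t : ι → κ → μ → K} {s : ι' → κ' → μ' → K} {c : ℝ}
    (hne : ∀ n, ∃ m, TensorMonRestrictsTo (kroneckerPow t m) (kroneckerPow s (n + 1)))
    (hc : ∀ m n, TensorMonRestrictsTo (kroneckerPow t m) (kroneckerPow s (n + 1)) →
      c * ((n : ℝ) + 1) ≤ m) :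
    c ≤ monRelativeExponent t s := by
  refine le_ciInf fun n => ?_
  have hpos : (0 : ℝ) < (n : ℝ) + 1 := by positivity
  rw [le_div_iff₀ hpos]
  exact hc _ n (tensorMonRestrictsTo_monRestrictionCost_of_nonempty (hne n))

/-- **Upper bounds on `ω(t,s)` in the limit**: witnesses of ratio `≤ c + ε` for every `ε > 0` give
`ω(t,s) ≤ c`. [cite: ChristandlVranaZuiddam2021, Def. 2] -/
theorem relativeExponent_le_of_forall_pos {t : ι → κ → μ → K} {s : ι' → κ' → μ' → K} {c : ℝ}
    (h : ∀ ε : ℝ, 0 < ε → ∃ n m, TensorRestrictsTo (kroneckerPow t m) (kroneckerPow s (n + 1)) ∧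
      (m : ℝ) / ((n : ℝ) + 1) ≤ c + ε) :
    relativeExponent t s ≤ c := by
  refine le_of_forall_pos_le_add fun ε hε => ?_
  obtain ⟨n, m, hw, hle⟩ := h ε hε
  exact (relativeExponent_le_div hw).trans hle

/-- Monomial analogue of `relativeExponent_le_of_forall_pos`; a monomial witness family bounds
both `ω_M(t,s)` and `ω(t,s)`. [cite: ChristandlVranaZuiddam2021, §2.4] -/
theorem monRelativeExponent_le_of_forall_pos {t : ι → κ → μ → K} {s : ι' → κ' → μ' → K} {c : ℝ}
    (h : ∀ ε : ℝ, 0 < ε → ∃ n m, TensorMonRestrictsTo (kroneckerPow t m) (kroneckerPow s (n + 1)) ∧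
      (m : ℝ) / ((n : ℝ) + 1) ≤ c + ε) :
    monRelativeExponent t s ≤ c ∧ relativeExponent t s ≤ c := by
  refine ⟨le_of_forall_pos_le_add fun ε hε => ?_, relativeExponent_le_of_forall_pos fun ε hε => ?_⟩
  · obtain ⟨n, m, hw, hle⟩ := h ε hε
    exact (monRelativeExponent_le_div hw).trans hle
  · obtain ⟨n, m, hw, hle⟩ := h ε hε
    exact ⟨n, m, hw.tensorRestrictsTo, hle⟩

/-- Infima of nonnegative real sequences multiply termwise lower bounds:
`x ≤ a_p · b_n` for all `p, n` implies `x ≤ (inf a)(inf b)`. [folklore] -/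
theorem le_ciInf_mul_ciInf {a b : ℕ → ℝ} {x : ℝ} (ha : ∀ p, 0 ≤ a p) (hb : ∀ n, 0 ≤ b n)
    (h : ∀ p n, x ≤ a p * b n) : x ≤ (⨅ p, a p) * ⨅ n, b n := by
  have hA : 0 ≤ ⨅ p, a p := Real.iInf_nonneg ha
  have hB : 0 ≤ ⨅ n, b n := Real.iInf_nonneg hb
  -- first infimum
  have step : ∀ n, x ≤ (⨅ p, a p) * b n := by
    intro n
    rcases (hb n).eq_or_lt with h0 | hpos
    · rw [← h0, mul_zero]
      have := h 0 n
      rwa [← h0, mul_zero] at this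
    · have : x / b n ≤ ⨅ p, a p := le_ciInf fun p => by
        rw [div_le_iff₀ hpos]; exact h p n
      rwa [div_le_iff₀ hpos] at this
  rcases hA.eq_or_lt with h0 | hpos
  · rw [← h0, zero_mul]
    have := step 0
    rwa [← h0, zero_mul] at this
  · have : x / (⨅ p, a p) ≤ ⨅ n, b n := le_ciInf fun n => by
      rw [div_le_iff₀ hpos, mul_comm]; exact step n
    rwa [div_le_iff₀ hpos, mul_comm] at this

end Bounds

/-! ## The triangle inequality (CVZ Prop. 3 and Prop. 7, second items) -/

section Triangle

variable {K : Type u} [CommSemiring K]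
variable {ιs κs μs ι κ μ ιu κu μu : Type*} [Fintype ιs] [Fintype κs] [Fintype μs] [Fintype ι]
  [Fintype κ] [Fintype μ] [Fintype ιu] [Fintype κu] [Fintype μu]

/-- Real-arithmetic bookkeeping for the triangle inequality: `(m k)/((p n + p + n) + 1) = (k/(p+1))(m/(n+1))`.
[folklore] -/
theorem cast_mul_div_succ_mul_succ (m k p n : ℕ) :
    ((m * k : ℕ) : ℝ) / (((p * n + p + n : ℕ) : ℝ) + 1) =
      (k : ℝ) / ((p : ℝ) + 1) * ((m : ℝ) / ((n : ℝ) + 1)) := by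
  have hp : (0 : ℝ) < (p : ℝ) + 1 := by positivity
  have hn : (0 : ℝ) < (n : ℝ) + 1 := by positivity
  have e : (((p * n + p + n : ℕ) : ℝ) + 1) = ((p : ℝ) + 1) * ((n : ℝ) + 1) := by push_cast; ring
  rw [e]
  field_simp
  push_cast
  ring

/-- **CVZ 2021, Prop. 3 (triangle inequality)**: `ω(s,u) ≤ ω(s,t) · ω(t,u)`, for the tree's
infimum formalisation of relative exponents, under the finiteness hypotheses that every set
defining `ω(s,t)` and `ω(t,u)` is nonempty. [cite: ChristandlVranaZuiddam2021, Prop. 3] -/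
theorem relativeExponent_triangle {s : ιs → κs → μs → K} {t : ι → κ → μ → K}
    {u : ιu → κu → μu → K}
    (hst : ∀ p, ∃ k, TensorRestrictsTo (kroneckerPow s k) (kroneckerPow t (p + 1)))
    (htu : ∀ n, ∃ m, TensorRestrictsTo (kroneckerPow t m) (kroneckerPow u (n + 1))) :
    relativeExponent s u ≤ relativeExponent s t * relativeExponent t u := by
  classical
  refine le_ciInf_mul_ciInf (fun p => by positivity) (fun n => by positivity) fun p n => ?_
  set k := restrictionCost s t (p + 1) with hk
  set m := restrictionCost t u (n + 1) with hm
  have h₁ : TensorRestrictsTo (kroneckerPow s k) (kroneckerPow t (p + 1)) :=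
    tensorRestrictsTo_restrictionCost_of_nonempty (hst p)
  have h₂ : TensorRestrictsTo (kroneckerPow t m) (kroneckerPow u (n + 1)) :=
    tensorRestrictsTo_restrictionCost_of_nonempty (htu n)
  have h₃ : TensorRestrictsTo (kroneckerPow s (m * k)) (kroneckerPow u ((p * n + p + n) + 1)) :=
    (tensorRestrictsTo_chain h₁ h₂).trans
      (tensorMonRestrictsTo_kroneckerPow_of_eq u (by ring)).tensorRestrictsTo
  have h₄ := relativeExponent_le_div h₃
  rwa [cast_mul_div_succ_mul_succ] at h₄

/-- **CVZ 2021, Prop. 7 (triangle inequality for `ω_M`)**: `ω_M(s,u) ≤ ω_M(s,t) · ω_M(t,u)`, under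
the finiteness hypotheses that every set defining `ω_M(s,t)` and `ω_M(t,u)` is nonempty.
[cite: ChristandlVranaZuiddam2021, Prop. 7] -/
theorem monRelativeExponent_triangle {s : ιs → κs → μs → K} {t : ι → κ → μ → K}
    {u : ιu → κu → μu → K}
    (hst : ∀ p, ∃ k, TensorMonRestrictsTo (kroneckerPow s k) (kroneckerPow t (p + 1)))
    (htu : ∀ n, ∃ m, TensorMonRestrictsTo (kroneckerPow t m) (kroneckerPow u (n + 1))) :
    monRelativeExponent s u ≤ monRelativeExponent s t * monRelativeExponent t u := by
  classical
  refine le_ciInf_mul_ciInf (fun p => by positivity) (fun n => by positivity) fun p n => ?_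
  set k := monRestrictionCost s t (p + 1) with hk
  set m := monRestrictionCost t u (n + 1) with hm
  have h₁ : TensorMonRestrictsTo (kroneckerPow s k) (kroneckerPow t (p + 1)) :=
    tensorMonRestrictsTo_monRestrictionCost_of_nonempty (hst p)
  have h₂ : TensorMonRestrictsTo (kroneckerPow t m) (kroneckerPow u (n + 1)) :=
    tensorMonRestrictsTo_monRestrictionCost_of_nonempty (htu n)
  have h₃ : TensorMonRestrictsTo (kroneckerPow s (m * k)) (kroneckerPow u ((p * n + p + n) + 1)) :=
    (tensorMonRestrictsTo_chain h₁ h₂).trans (tensorMonRestrictsTo_kroneckerPow_of_eq u (by ring))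
  have h₄ := monRelativeExponent_le_div h₃
  rwa [cast_mul_div_succ_mul_succ] at h₄

omit [Fintype ιu] [Fintype κu] [Fintype μu] in
/-- Nonemptiness of all defining sets from one witness: `t^{⊗m₀} ≥ s` gives
`t^{⊗((n+1) m₀)} ≥ s^{⊗(n+1)}` for every `n`. [cite: ChristandlVranaZuiddam2021, Def. 2] -/
theorem exists_tensorRestrictsTo_pow_of_witness {t : ι → κ → μ → K} {s : ιu → κu → μu → K}
    {m₀ : ℕ} (h : TensorRestrictsTo (kroneckerPow t m₀) s) (n : ℕ) :
    ∃ m, TensorRestrictsTo (kroneckerPow t m) (kroneckerPow s (n + 1)) :=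
  ⟨(n + 1) * m₀, (tensorMonRestrictsTo_kroneckerPow_mul t (n + 1) m₀).tensorRestrictsTo.trans
    (h.kroneckerPow (n + 1))⟩

omit [Fintype ιu] [Fintype κu] [Fintype μu] in
/-- Monomial analogue of `exists_tensorRestrictsTo_pow_of_witness`.
[cite: ChristandlVranaZuiddam2021, §2.4] -/
theorem exists_tensorMonRestrictsTo_pow_of_witness {t : ι → κ → μ → K} {s : ιu → κu → μu → K}
    {m₀ : ℕ} (h : TensorMonRestrictsTo (kroneckerPow t m₀) s) (n : ℕ) :
    ∃ m, TensorMonRestrictsTo (kroneckerPow t m) (kroneckerPow s (n + 1)) :=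
  ⟨(n + 1) * m₀, tensorMonRestrictsTo_kroneckerPow_mul_of h (n + 1)⟩

end Triangle

end Literature.Computability.AlgebraicComplexity

end
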